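import Summits.AnomalousDissipation.AnomalousDissipation.Theorems.SolenoidalFractalHomogenisationLagrangianStepVmodSlowTestTools
import Summits.AnomalousDissipation.AnomalousDissipation.Theorems.SolenoidalFractalHomogenisationLagrangianStepVmodGeneratorPairing
import Summits.AnomalousDissipation.AnomalousDissipation.Theorems.SolenoidalFractalHomogenisationLagrangianStepVmodSSReduce
import Summits.AnomalousDissipation.AnomalousDissipation.Theorems.SolenoidalFractalHomogenisationLagrangianStepCellCorrectorContent
import Literature.Analysis.FluidPDE.PassiveVectorTensorPropagatorTestIdentity
import HarnessLib

/-!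
# K1L_D (stmt-AnomalousDissipation-27980), (V_mod) flat stage (ℓ2), (fs) block: the PER-MODE GENERATOR BOUND for a FAST datum under the cell member
# (the `τ·Γ_ℓ` partner of the leak bound `VmodGen.norm_fc_slow_le_of_fast` in the `min(generator, leak)` of the certifier's table §4 (fs);
# prover ad-k1loc-p3 g10, `--supports 27980 --as helper`)

For the cell member `U` (propagator of `cellField W M hM ν n`, tensor `(1/n²)𝔸`, `NearIso 𝔸 (ν·lo/λ) (ν·hi·λ)`, `OddSmall 𝔸 (νβ)`), a FAST datum `f`
(no modes in `freqBall (n/4)`), a slow frequency `ℓ ∈ freqBall (n/4)` and a window `0 ≤ s ≤ t ≤ Tw` (ANY phase `s`):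

  `‖𝓕(U s t f)(ℓ)‖ ≤ (t − s) · (3k/n + 4π²·ν(hi·Λ + β/2)·⌊n/4⌋/n²) · |ℓ| · ‖f‖`      (`norm_fc_apply_le_of_fast`)

Proof: pair `U s t f` with the single real mode `G_z = Re(e_ℓ • z)`, `z = 𝓕(U s t f)(ℓ)` (transversal, `U` solenoidal): `⟪U s t f, G_z⟫ = Re⟪z, z⟫ = ‖z‖²`
(`integral_inner_realTrigPoly_singleton`); `⟪f, G_z⟫ = 0` (fast ⟂ slow); du Bois-Reymond at propagator level (`…PropagatorTestIdentity`, p710945) +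
the test-side generator bound (`…VmodGeneratorPairing`, p711586; `G_z` is its own truncation, `S_N(G_z) ≤ |ℓ|·‖z‖`, `‖cellField‖_∞ ≤ k/(2πn)`) give
`‖z‖² ≤ (t − s)·A·|ℓ|·‖z‖·‖f‖`.  With `…VmodFastSlowAssembly` (p713117) this is the generator input of the (fs) block on its unsaturated modes.
NOT a proof of any block, of `stub_Vmod_EHT`, of K1L_D or of AD; rung F-D1.A0.
-/

set_option linter.dupNamespace false

noncomputable section

namespace Summit.AnomalousDissipation.AnomalousDissipation.Theorems.SolenoidalFractalHomogenisation.LagrangianStep.VmodFlat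

open Literature.Analysis Literature.Analysis.FluidPDE Literature.Analysis.FunctionSpaces
open MeasureTheory Set Filter UnitAddTorus
open scoped ENNReal NNReal InnerProductSpace
open Summit.AnomalousDissipation.AnomalousDissipation.Theorems.SolenoidalFractalHomogenisation.LagrangianStep.CellClauseMod
open Summit.AnomalousDissipation.AnomalousDissipation.Theorems.SolenoidalFractalHomogenisation.RealisedQuasiStaticCellLaw
  (isSmooth_cell isDivFree_cell memLp_top_stLift_cell)

/-- `‖y‖² = ∫ ‖⇑y‖²` for a class `y : V2`. [folklore] -/
theorem norm_sq_eq_integral_coe (y : V2) : ‖y‖ ^ 2 = ∫ z, ‖(y : VF) z‖ ^ 2 := by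
  rw [← real_inner_self_eq_norm_sq, MeasureTheory.L2.inner_def]
  exact integral_congr_ae (ae_of_all _ fun z => real_inner_self_eq_norm_sq _)

set_option maxHeartbeats 1600000 in
/-- **PER-MODE GENERATOR BOUND FOR A FAST DATUM UNDER THE CELL MEMBER** (any phase `s`): for `f` fast and `ℓ ∈ freqBall (n/4)`,
`‖𝓕(U s t f)(ℓ)‖ ≤ (t − s)·(6π·(k/(2πn)) + 4π²·((1/n²)ν·hi·Λ + (1/n²)νβ/2)·⌊n/4⌋)·√|ℓ|²·‖f‖`. -/
theorem norm_fc_apply_le_of_fast {k : ℕ} (W : LatticeShear.LatticeWord k) (M : ℝ) (hM : 0 < M) {lo hi Λ β : ℝ}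
    (hlo : 0 < lo) (hhi : 0 ≤ hi) (hΛ : 1 ≤ Λ) (hβ : 0 ≤ β) {ν : ℝ} (hν : 0 < ν) {n : ℕ} (hn : 0 < n) {𝔸 : Torus.Visc4 (Fin 3)}
    (hodd : Torus.OddSmall 𝔸 (ν * β)) (hwin : ∃ lam ∈ Set.Icc (1:ℝ) Λ, Torus.NearIso 𝔸 (ν * (lo / lam)) (ν * (hi * lam)))
    {Tw : ℝ} {U : ℝ → ℝ → (V2 →L[ℝ] V2)} (hU : Torus.IsPropagator Tw (cellField W M hM ν hν n) ((1 / (n:ℝ) ^ 2) • 𝔸) U)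
    {s t : ℝ} (hs : 0 ≤ s) (hst : s ≤ t) (htT : t ≤ Tw) (f : V2) (hf : IsFast n f)
    {ℓ : Fin 3 → ℤ} (hℓ : ℓ ∈ Torus.freqBall (d := Fin 3) (n / 4)) :
    ‖fc (U s t f) ℓ‖ ≤ (t - s) * (6 * Real.pi * ((k:ℝ) / (2 * Real.pi * (n:ℝ))) +
        4 * Real.pi ^ 2 * ((1 / (n:ℝ) ^ 2) * (ν * (hi * Λ)) + (1 / (n:ℝ) ^ 2) * (ν * β) / 2) * ((n / 4 : ℕ) : ℝ))
      * Real.sqrt (Torus.freqNormSq ℓ) * ‖f‖ := by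
  have hn0 : (0:ℝ) < n := by exact_mod_cast hn
  have hn2 : (0:ℝ) < 1 / (n:ℝ) ^ 2 := by positivity
  have hΛ0 : 0 < Λ := by linarith
  set N₄ : ℕ := n / 4 with hN₄
  -- the cell tensor, `lam`-free window
  obtain ⟨lam, hlam, hA𝔸⟩ := hwin
  have hlam0 : 0 < lam := by linarith [hlam.1]
  have hAΛ : Torus.NearIso 𝔸 (ν * (lo / Λ)) (ν * (hi * Λ)) :=
    hA𝔸.mono (mul_le_mul_of_nonneg_left (div_le_div_of_nonneg_left hlo.le hlam0 hlam.2) hν.le)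
      (mul_le_mul_of_nonneg_left (mul_le_mul_of_nonneg_left hlam.2 hhi) hν.le)
  have hcell : Torus.NearIso ((1 / (n:ℝ) ^ 2) • 𝔸) ((1 / (n:ℝ) ^ 2) * (ν * (lo / Λ))) ((1 / (n:ℝ) ^ 2) * (ν * (hi * Λ))) := hAΛ.smul hn2.le
  have hcell_lo0 : 0 < (1 / (n:ℝ) ^ 2) * (ν * (lo / Λ)) := mul_pos hn2 (mul_pos hν (div_pos hlo hΛ0))
  have hcell_hi : 0 ≤ (1 / (n:ℝ) ^ 2) * (ν * (hi * Λ)) := by positivity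
  have hcell_odd : Torus.OddSmall ((1 / (n:ℝ) ^ 2) • 𝔸) ((1 / (n:ℝ) ^ 2) * (ν * β)) := hodd.smul _
  have hcell_β : 0 ≤ (1 / (n:ℝ) ^ 2) * (ν * β) := by positivity
  -- carrier data on the longer horizon `Tw + 1`
  have hTw1 : Tw < Tw + 1 := by linarith
  have hbU : MemLp (Torus.stLift (cellField W M hM ν hν n)) ∞ (volume.restrict (Ioo 0 (Tw + 1) ×ˢ (univ : Set (EuclideanSpace ℝ (Fin 3))))) :=
    memLp_top_stLift_cell _ n (Tw + 1)
  have hbUdiv : ∀ᵐ τ ∂(volume.restrict (Ioo (0:ℝ) (Tw + 1))), Torus.IsWeaklyDivFree (cellField W M hM ν hν n τ) :=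
    ae_of_all _ fun τ => (isDivFree_cell _ n τ).isWeaklyDivFree_holds (isSmooth_cell _ n τ)
  have hB : ∀ τ y, ‖cellField W M hM ν hν n τ y‖ ≤ k / (2 * Real.pi * n) := fun τ y => by
    unfold cellField; exact norm_cell_le_div _ hn τ y
  have hB0 : 0 ≤ (k:ℝ) / (2 * Real.pi * n) := by positivity
  -- the single real mode carried by the slow coefficient
  set z : EuclideanSpace ℂ (Fin 3) := fc (U s t f) ℓ with hzdef
  have hz : Torus.kdot ℓ z = 0 := kdot_mFourierCoeff_eq_zero (Lp.memLp _) (hU.divFree s t f) ℓ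
  set G : VF := Torus.realTrigPoly {ℓ} (fun _ => z) with hGdef
  have hG : Torus.IsSmooth G := Torus.isSmooth_realTrigPoly _ _
  have hGdiv : Torus.IsDivFree G := Torus.isDivFree_realTrigPoly_singleton (by rw [← Torus.kdot_apply]; exact hz)
  have hGmem : MemLp G 2 volume := hG.memLp 2
  have hGw : Torus.IsWeaklyDivFree G := hGdiv.isWeaklyDivFree_holds hG
  -- `G` is its own truncation at level `N₄`
  have hℓN : Torus.freqNormSq ℓ ≤ (N₄ : ℝ) ^ 2 := Torus.mem_freqBall.1 hℓ
  have hGtrunc : Torus.fourierTruncate N₄ G = G :=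
    Torus.fourierTruncate_eq_self hG.continuous fun k' hk' =>
      Torus.mFourierCoeff_realTrigPoly_singleton_eq_zero ℓ _ (lt_of_le_of_lt hℓN hk')
  -- the class `G'` is slow, and `⟪f, G'⟫ = 0`
  set G' : V2 := hGmem.toLp G with hG'def
  have hfcG' : ∀ k', fc G' k' = mFourierCoeff (EuclideanSpace.complexify ∘ G) k' := fun k' => by
    rw [fc]; exact Torus.mFourierCoeff_congr_ae ((hGmem.coeFn_toLp (μ := volume)).fun_comp EuclideanSpace.complexify) k'
  have hG'slow : IsSlow n G' := by
    intro k' hk'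
    rw [hfcG']
    exact Torus.mFourierCoeff_realTrigPoly_singleton_eq_zero ℓ _ (lt_of_le_of_lt hℓN (Torus.not_mem_freqBall.1 hk'))
  have hfG' : ⟪f, G'⟫_ℝ = 0 := by
    refine inner_eq_zero_of_fc_disjoint fun k' => ?_
    by_cases hk' : k' ∈ Torus.freqBall (d := Fin 3) (n / 4)
    · exact Or.inl (hf k' hk')
    · exact Or.inr (hG'slow k' hk')
  -- `⟪U s t f, G'⟫ = ‖z‖²`
  have hpair : ⟪U s t f, G'⟫_ℝ = ‖z‖ ^ 2 := by
    rw [MeasureTheory.L2.inner_def]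
    have e1 : ∫ x, ⟪((U s t f : V2) : VF) x, (G' : VF) x⟫_ℝ = ∫ x, ⟪((U s t f : V2) : VF) x, G x⟫_ℝ :=
      integral_congr_ae (by
        filter_upwards [hGmem.coeFn_toLp (μ := volume)] with x hx
        rw [hx])
    rw [e1, Torus.integral_inner_realTrigPoly_singleton (integrable_coe_V2 (U s t f)) ℓ (fun _ => z)]
    have h2 : (⟪z, z⟫_ℂ).re = ‖z‖ ^ 2 := by
      have := inner_self_eq_norm_sq (𝕜 := ℂ) z
      simpa using this
    exact h2
  -- the du Bois-Reymond identity and the generator bound on its integrand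
  set g : ℝ → ℝ := fun τ => ∫ x, ⟪((U s τ f : V2) : VF) x,
      Torus.convect (cellField W M hM ν hν n τ) G x + Torus.viscAdj ((1 / (n:ℝ) ^ 2) • 𝔸) G x⟫_ℝ with hgdef
  have hid : ⟪U s t f, G'⟫_ℝ = ⟪f, G'⟫_ℝ + ∫ τ in Ioc s t, g τ :=
    hU.inner_eq_inner_add_setIntegral_of_steadyTest hcell hcell_lo0 hTw1 hbU hbUdiv hG hGdiv hs hst htT f
  -- the gradient-weighted mode sum of the single mode
  set S2 : ℝ := ∑ k' ∈ Torus.freqBall N₄, Torus.freqNormSq k' * ‖mFourierCoeff (EuclideanSpace.complexify ∘ G) k'‖ ^ 2 with hS2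
  have hS2le : S2 ≤ Torus.freqNormSq ℓ * ‖z‖ ^ 2 := by
    have hterm : ∀ k' ∈ Torus.freqBall (d := Fin 3) N₄,
        Torus.freqNormSq k' * ‖mFourierCoeff (EuclideanSpace.complexify ∘ G) k'‖ ^ 2
          ≤ Torus.freqNormSq ℓ * ‖mFourierCoeff (EuclideanSpace.complexify ∘ G) k'‖ ^ 2 := by
      intro k' _
      by_cases hk' : Torus.freqNormSq k' ≤ Torus.freqNormSq ℓ
      · exact mul_le_mul_of_nonneg_right hk' (sq_nonneg _)
      · rw [Torus.mFourierCoeff_realTrigPoly_singleton_eq_zero ℓ _ (not_le.1 hk'), norm_zero]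
        simp
    have hB1 : ∑ k' ∈ Torus.freqBall N₄, ‖mFourierCoeff (EuclideanSpace.complexify ∘ G) k'‖ ^ 2 ≤ ‖z‖ ^ 2 :=
      (sum_norm_sq_mFourierCoeff_le_integral hGmem _).trans (Torus.integral_norm_sq_realTrigPoly_singleton_le ℓ (fun _ => z))
    calc S2 ≤ ∑ k' ∈ Torus.freqBall N₄, Torus.freqNormSq ℓ * ‖mFourierCoeff (EuclideanSpace.complexify ∘ G) k'‖ ^ 2 := Finset.sum_le_sum hterm
      _ = Torus.freqNormSq ℓ * ∑ k' ∈ Torus.freqBall N₄, ‖mFourierCoeff (EuclideanSpace.complexify ∘ G) k'‖ ^ 2 := by rw [Finset.mul_sum]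
      _ ≤ Torus.freqNormSq ℓ * ‖z‖ ^ 2 := mul_le_mul_of_nonneg_left hB1 (Torus.freqNormSq_nonneg ℓ)
  have hsqS2 : Real.sqrt S2 ≤ Real.sqrt (Torus.freqNormSq ℓ) * ‖z‖ := by
    calc Real.sqrt S2 ≤ Real.sqrt (Torus.freqNormSq ℓ * ‖z‖ ^ 2) := Real.sqrt_le_sqrt hS2le
      _ = Real.sqrt (Torus.freqNormSq ℓ) * ‖z‖ := by rw [Real.sqrt_mul (Torus.freqNormSq_nonneg ℓ), Real.sqrt_sq (norm_nonneg _)]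
  set A : ℝ := 6 * Real.pi * ((k:ℝ) / (2 * Real.pi * (n:ℝ))) +
      4 * Real.pi ^ 2 * ((1 / (n:ℝ) ^ 2) * (ν * (hi * Λ)) + (1 / (n:ℝ) ^ 2) * (ν * β) / 2) * (N₄:ℝ) with hAdef
  have hA0 : 0 ≤ A := by positivity
  have hg : ∀ τ, |g τ| ≤ A * (Real.sqrt (Torus.freqNormSq ℓ) * ‖z‖) * ‖f‖ := by
    intro τ
    have hu : MemLp ((U s τ f : V2) : VF) 2 volume := Lp.memLp _
    have hudiv : Torus.IsWeaklyDivFree ((U s τ f : V2) : VF) := hU.divFree s τ f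
    have hb : AEStronglyMeasurable (cellField W M hM ν hν n τ) volume := (isSmooth_cell _ n τ).continuous.aestronglyMeasurable
    have key := abs_integral_inner_generator_fourierTruncate_le hu hudiv hb hB0 (hB τ) hGmem hGw hcell hcell_lo0.le hcell_hi hcell_odd hcell_β N₄
    rw [hGtrunc] at key
    have hnorm : Real.sqrt (∫ x, ‖((U s τ f : V2) : VF) x‖ ^ 2) ≤ ‖f‖ := by
      rw [← norm_sq_eq_integral_coe, Real.sqrt_sq (norm_nonneg _)]
      exact hU.norm_le s τ f
    calc |g τ| ≤ A * Real.sqrt S2 * Real.sqrt (∫ x, ‖((U s τ f : V2) : VF) x‖ ^ 2) := key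
      _ ≤ A * (Real.sqrt (Torus.freqNormSq ℓ) * ‖z‖) * ‖f‖ :=
          mul_le_mul (mul_le_mul_of_nonneg_left hsqS2 hA0) hnorm (Real.sqrt_nonneg _) (by positivity)
  have hts : 0 ≤ t - s := sub_nonneg.2 hst
  have hint : |∫ τ in Ioc s t, g τ| ≤ A * (Real.sqrt (Torus.freqNormSq ℓ) * ‖z‖) * ‖f‖ * (t - s) := by
    have h := norm_setIntegral_le_of_norm_le_const_ae' (f := g) (s := Ioc s t) (μ := volume)
      (C := A * (Real.sqrt (Torus.freqNormSq ℓ) * ‖z‖) * ‖f‖) measure_Ioc_lt_top (ae_of_all _ fun τ _ => by rw [Real.norm_eq_abs]; exact hg τ)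
    rw [Real.norm_eq_abs, Measure.real, Real.volume_Ioc, ENNReal.toReal_ofReal hts] at h
    exact h
  -- `‖z‖² ≤ (t − s)·A·|ℓ|·‖z‖·‖f‖`
  have hzz : ‖z‖ ^ 2 ≤ ((t - s) * A * Real.sqrt (Torus.freqNormSq ℓ) * ‖f‖) * ‖z‖ := by
    have h1 : ‖z‖ ^ 2 = ∫ τ in Ioc s t, g τ := by rw [← hpair, hid, hfG', zero_add]
    calc ‖z‖ ^ 2 ≤ |∫ τ in Ioc s t, g τ| := by rw [← h1]; exact le_abs_self _
      _ ≤ A * (Real.sqrt (Torus.freqNormSq ℓ) * ‖z‖) * ‖f‖ * (t - s) := hint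
      _ = ((t - s) * A * Real.sqrt (Torus.freqNormSq ℓ) * ‖f‖) * ‖z‖ := by ring
  have hC0 : 0 ≤ (t - s) * A * Real.sqrt (Torus.freqNormSq ℓ) * ‖f‖ := by positivity
  by_cases hz0 : ‖z‖ = 0
  · rw [hz0]; exact hC0
  · have hzpos : 0 < ‖z‖ := lt_of_le_of_ne (norm_nonneg _) (Ne.symm hz0)
    have : ‖z‖ * ‖z‖ ≤ ((t - s) * A * Real.sqrt (Torus.freqNormSq ℓ) * ‖f‖) * ‖z‖ := by rw [← sq]; exact hzz
    exact le_of_mul_le_mul_right this hzpos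

end Summit.AnomalousDissipation.AnomalousDissipation.Theorems.SolenoidalFractalHomogenisation.LagrangianStep.VmodFlat

end
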